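import Summits.QuantumFields.YangMills.Theorems.BalabanUVNodesN09ChartLettersAnalytic
import Literature.MathematicalPhysics.QuantumFieldTheory.Balaban1983to89.Node00.CarriersB12Datum
import Literature.MathematicalPhysics.QuantumFieldTheory.Balaban1983to89.Node00.Record13CarriersCoPH

/-!
# NODE N09 [B12] — THE DATUM LAW OF `BalabanUVNodesN09ChartLettersAnalytic` AT MODULE E's PRESENTATION `χ.withDatum δ`: the coarse datum
# `B = Q(η·Λ(𝐀|□₀, h(𝐔)|□₀))` of (3.30) IS ANALYTIC ALONG EVERY ANALYTIC FAMILY OF THE VARIABLES once the residual letter `h(𝐔) = L⁻¹𝐇_{k+1}(□₀, (1/i) log V(𝐔))`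
# of (3.26)–(3.27) is ([I] p. 276 *«these gauge transformations are explicitly given analytic functions of 𝐔»*) — the joint analyticity of
# `Λ(a, h) = (iη)⁻¹ log(e^{iηa} e^{iηh})` in BOTH letters; hence `hKan` ∕ `hA2an` at a presented run from the chart laws, `W`∕`T` analytic and ONE law about `h`

WIDTH SEAT `pub-ymgap-dag-n09-w1` (g0, 2026-08-27; HUMAN RULING D-0149; plan g77 `W-SEAT-START-LIST.md` §n09 ITEM 1, second file; key K1⁷ `stmt-QuantumFields-20542`,
`--supports`, COUNT-NEUTRAL helper).  APPEND-ONLY GROWTH: a NEW importing module; my `…N09ChartLettersAnalytic` (p?????? — `hKan_of_chart`, `hA2an_of_chart`,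
`leaf_of_chart_of_analytic`), node00-def-B12's MODULE E `Node00/CarriersB12Datum` (p485992: `DatumB12Pres`, `scrA`, `fldB`, `withDatum`, `A331Of`) and lit r20's
`B12QPrime348` ∕ `B12Membership313II` (`newPot`, `bchLog`, `norm_expMul_smul_sub_one_lt_one`) are CONSUMED BY NAME; nothing landed is edited or retyped.

PRINT.  [I] = T. Bałaban, CMP **109** (1987), (3.26)–(3.27) p. 275 (`V(𝐔)` = the generalized axial gauge of [15] Sect. F, `h = L⁻¹𝐇_{k+1}(□₀, (1/i) log V)`), p. 276:
*«It is easy to see that these gauge transformations are explicitly given analytic functions of 𝐔»*; (3.30) p. 276: *«B = (1/iη) log [exp iηA · exp(iL⁻¹η𝐇_{k+1}(□₀,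
(1/i) log V))] on □₀»*; (3.31) p. 276 (`|𝐀| < α₂` on `□₀`); (3.48)–(3.49) p. 279 (*«analytic function of 𝐀»*); Lemma 4 p. 280: *«The functions in (3.53) are analytic»*.

WHAT IS PROVED (kernel, sorry-free, theorems only).
§1 [folklore + (3.48)–(3.49)] `analyticAt_bchLog_comp`, `analyticAt_newPot_comp` — `Λ(a, h) = (iη)⁻¹ log(e^{iηa} e^{iηh})` is JOINTLY analytic: along analytic families
   `e ↦ a(e)`, `e ↦ h(e)` with `η(‖a(e₀)‖ + ‖h(e₀)‖) ≤ 1/4`, `e ↦ Λ(a(e), h(e))` is analytic (r20's `analyticAt_newPot_left` is the one-letter case; same three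
   bricks: the entire `exp`, the product, the logarithmic series `analyticAt_logOnePlus`).
§2 AT MODULE E's PRESENTATION (`δ : DatumB12Pres P N`, index `i`): `analyticAt_scrA_apply` (bondwise `A = Λ(𝐀|□₀, h|□₀)`), `analyticAt_fldB` (`B = Q(ηA)`, `Q` a CLM) —
   along a family on which `𝐀` is analytic letter-wise with `|𝐀(e₀)| < α₂` on `□₀` ((3.31)), `h(𝐔(e))` is analytic letter-wise on `□₀` with `|h(𝐔(e₀))| < α′`
   there ((3.27)-type law of module E ∕ F), and `η(α₂ + α′) ≤ 1/8`.
§3 AT THE PRESENTED RUN `χ.withDatum δ`: **`hBan_withDatum`** — file 1's datum law (iii) («`B = χ.fldB` analytic along analytic families on the domain») DERIVED from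
   module E's displayed (3.27)-type size law `hh` (verbatim the hypothesis of `Node00.ChartB12Run.dat_lt_withDatum`), `0 < η`, `η(α₂ + α′) ≤ 1/8`, and ONE displayed law
   `hhan`: «for `(𝐔, 𝐉)` in the (3.40)-space, `h(𝐔)` is analytic along analytic families of `𝐔`, bondwise on `□₀`» — print's p. 276 sentence about (3.26)–(3.27);
   **`hKan_withDatum`**, **`hA2an_withDatum`** — file 1's `hKan_of_chart` ∕ `hA2an_of_chart` at `χ.withDatum δ` with (iii) so discharged; `leaf_withDatum_of_analytic`
   — file 1's `leaf_of_chart_of_analytic` (LEMMA 4 (3.53) `B12LeafOfRecord Rz cB (χ.withDatum δ).toResid`) likewise.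
§4 `lemma4Printed_pinB12_of_chart_of_analytic` — AT def-T's v1.7 H-PARAMETER: the `h09` binder text of dag-n12-d's S-bound four-pin engine
   (`Thm/BalabanUVNodesN12AtRecord13SepCoPHSockets` :116: `Lemma4Printed (θ.toStage13Params.res.X P).F12 (…).c12`) at the [B12]-PINNED parameter
   `θ := θ₀.pinB12 lam12` (def-T `Record13CarriersCoPH` :106) with a CHARTED `lam12 := fun q => (χ q).toResid` — file 1's §4 by `rfl` through the pin.

HONEST SCOPE ∕ A6 (№189).  (a) What moved: at a presented run the datum-analyticity law of file 1 is no longer a hypothesis about the composite `B`; what replaces it is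
print's own sentence about the residual letter `h(𝐔)` (p. 276) plus module E's ALREADY-DISPLAYED size law and smallness line — no new numeric letter.  (b) What did
NOT move: `h = hBox` itself (no tree object: the `(k+1)`-st chart (3.27), the axial gauge `V(𝐔)` (3.26) — node00-def-B12 TRIGGERS (t4) ERRATUM (α)–(γ)), the
`JInputsRef` residue, the 13 datum-free chart laws; N09 is NOT discharged; counts unmoved (typed 28∕28 · discharged 5∕27).  `Rz`-GENERIC: every theorem
holds for an arbitrary residual recipe `Rz` and reads none of the package's identity fields (3.38)∕(3.39)+(3.37)∕(3.42) — so it is neither touched by nor an answer to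
dag-ref-L's SECOND-GAP-1 (pub-ymgap INBOX 2026-08-27T23:23Z: at the unit recipe `RzOfRecord` those identity fields force FLAT letters; the cure is def-T's pin of `Rz.bgI`).  (c) Satisfiability: §3's hypotheses
hold jointly at the zero presentation `hBox = 0`, `Q = 0` on module D's zero scheme (`hh` with any `α′ > 0`, `hhan` by `analyticAt_const`) — physically vacuous
sanity only; NOT the objects of record.  (d) `MatA N = M_N(ℂ)` with the `L²`-operator norm is a complete normed `ℂ`-algebra (scope `Matrix.Norms.L2Operator`).
One finite 𝕋⁴ programme at fixed `ε = L^{−K}`, Bałaban AS PRINTED; the Yang–Mills mass gap (Clay) is NOT proved by any of this — R4 closes the conditional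
finite-𝕋⁴ rung `BalabanLadder.UV` only; nothing continuum ∕ ℝ⁴ ∕ infinite volume ∕ OS ∕ mass gap ∕ Clay.  No `sorry`, no `axiom`, no `def`, no `instance`, no `notation`.
-/

noncomputable section

namespace Summit.QuantumFields.YangMills.BalabanUVNodes.N09ChartDatumAnalytic

open Metric Set Filter Topology NormedSpace
open Complex (I)
open Literature.Analysis.Complex (logOnePlus analyticAt_logOnePlus mem_eball_expSeries_radius)
open Literature.MathematicalPhysics.QuantumFieldTheory.Balaban1983to89
open Literature.MathematicalPhysics.QuantumFieldTheory.Balaban1983to89.Node00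
open B12RegularSpaces111 (space)
open B12RegularSpaces111SpecialUnitary (suModel)
open B12Lemma4ConcreteFrame (LettersAnalyticAt)
open B12Membership313II (bchLog newPot)
open B12QPrime348 (norm_expMul_smul_sub_one_lt_one)
open Summit.QuantumFields.YangMills.BalabanUVNodes.N09ChartLettersAnalytic (hKan_of_chart hA2an_of_chart leaf_of_chart_of_analytic
  lemma4Printed_F12OfRecord₁₂_of_chart_of_analytic)
open Literature.MathematicalPhysics.QuantumFieldTheory.Balaban1983to89.T4Continuum (T4Family)
open scoped Matrix.Norms.L2Operator

/-! ## §1. `Λ(a, h) = (iη)⁻¹ log(e^{iηa} e^{iηh})` is jointly analytic (along analytic families of both letters) -/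

section BCH

variable {𝔸 : Type*} [NormedRing 𝔸] [NormedAlgebra ℂ 𝔸] [CompleteSpace 𝔸]
  {E : Type*} [NormedAddCommGroup E] [NormedSpace ℂ E] {f g : E → 𝔸} {e₀ : E}

/-- `e ↦ log(e^{f(e)} e^{g(e)})` is analytic at `e₀` along analytic `f`, `g` when `‖e^{f(e₀)} e^{g(e₀)} − 1‖ < 1` (entire `exp`, product, logarithmic series —
r20's `analyticAt_bchLog_left` with both letters moving). [cite: Balaban1987RG1, (3.30) p.276, (3.48)-(3.49) p.279] -/
theorem analyticAt_bchLog_comp (hf : AnalyticAt ℂ f e₀) (hg : AnalyticAt ℂ g e₀) (h : ‖exp (f e₀) * exp (g e₀) - 1‖ < 1) :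
    AnalyticAt ℂ (fun e => bchLog (f e) (g e)) e₀ := by
  have hef : AnalyticAt ℂ (fun e => exp (f e)) e₀ :=
    (analyticAt_exp_of_mem_ball (f e₀) (mem_eball_expSeries_radius (f e₀))).fun_comp hf
  have heg : AnalyticAt ℂ (fun e => exp (g e)) e₀ :=
    (analyticAt_exp_of_mem_ball (g e₀) (mem_eball_expSeries_radius (g e₀))).fun_comp hg
  have h1 : AnalyticAt ℂ (fun e => exp (f e) * exp (g e) - 1) e₀ := (hef.fun_mul heg).fun_sub analyticAt_const
  have h2 : AnalyticAt ℂ (logOnePlus : 𝔸 → 𝔸) (exp (f e₀) * exp (g e₀) - 1) := analyticAt_logOnePlus h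
  exact AnalyticAt.fun_comp (f := fun e => exp (f e) * exp (g e) - 1) (x := e₀) h2 h1

/-- **`Λ` of (3.30) is jointly analytic**: along analytic `a(e)`, `h(e)` with `η(‖a(e₀)‖ + ‖h(e₀)‖) ≤ 1/4` (`η ≥ 0`), `e ↦ Λ(a(e), h(e)) = newPot η (a e) (h e)` is analytic at
`e₀` (print: *«analytic function of 𝐀»* (3.48)–(3.49), and of `h`, which enters through *«explicitly given analytic functions of 𝐔»* p. 276).
[cite: Balaban1987RG1, (3.30) p.276, (3.48)-(3.49) p.279, p.276] -/
theorem analyticAt_newPot_comp {η : ℝ} (hη : 0 ≤ η) (hf : AnalyticAt ℂ f e₀) (hg : AnalyticAt ℂ g e₀) (h : η * (‖f e₀‖ + ‖g e₀‖) ≤ 1 / 4) :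
    AnalyticAt ℂ (fun e => newPot η (f e) (g e)) e₀ := by
  have hsm : ‖exp ((I * η : ℂ) • f e₀) * exp ((I * η : ℂ) • g e₀) - 1‖ < 1 := norm_expMul_smul_sub_one_lt_one hη h
  have hb : AnalyticAt ℂ (fun e => bchLog ((I * η : ℂ) • f e) ((I * η : ℂ) • g e)) e₀ :=
    analyticAt_bchLog_comp hf.fun_const_smul hg.fun_const_smul hsm
  show AnalyticAt ℂ (fun e => (I * η : ℂ)⁻¹ • bchLog ((I * η : ℂ) • f e) ((I * η : ℂ) • g e)) e₀
  exact hb.fun_const_smul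

end BCH

/-! ## §2. At module E's presentation: `A = Λ(𝐀|□₀, h|□₀)` bondwise and `B = Q(ηA)` along analytic families -/

section Presentation

variable {P : Params} {N M : ℕ} (δ : DatumB12Pres P N) (i : IdxB12 P M)
  {E : Type*} [NormedAddCommGroup E] [NormedSpace ℂ E] {Φf : E → FieldPair P 0 (MatA N)ˣ (MatA N)} {Af : E → PBond P 0 → MatA N} {e₀ : E}

/-- **`A(b) = Λ(𝐀(b), h(𝐔)(b))` is analytic along the family, bondwise**: on a bond of `□₀` from the analyticity of `e ↦ 𝐀(e)(b)`, `e ↦ h(𝐔(e))(b)` and the smallness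
`η(‖𝐀(e₀)(b)‖ + ‖h(𝐔(e₀))(b)‖) ≤ 1/4` (§1); off `□₀`, `A(b) = 0`. [cite: Balaban1987RG1, (3.30) p.276 («on □₀»), (3.48)-(3.49) p.279] -/
theorem analyticAt_scrA_apply (hη : 0 ≤ i.η) (b : PBond P 0)
    (hA : b ∈ (i.regionT 5).bonds → AnalyticAt ℂ (fun e => Af e b) e₀) (hh : b ∈ (i.regionT 5).bonds → AnalyticAt ℂ (fun e => δ.hBox (Φf e) b) e₀)
    (hsm : b ∈ (i.regionT 5).bonds → i.η * (‖Af e₀ b‖ + ‖δ.hBox (Φf e₀) b‖) ≤ 1 / 4) :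
    AnalyticAt ℂ (fun e => δ.scrA i (Φf e) (Af e) b) e₀ := by
  by_cases hb : b ∈ (i.regionT 5).bonds
  · have hfun : (fun e => δ.scrA i (Φf e) (Af e) b) = fun e => newPot i.η (Af e b) (δ.hBox (Φf e) b) := by
      funext e; exact δ.scrA_apply_of_mem i (Φf e) (Af e) hb
    rw [hfun]
    exact analyticAt_newPot_comp hη (hA hb) (hh hb) (hsm hb)
  · have hfun : (fun e => δ.scrA i (Φf e) (Af e) b) = fun _ => (0 : MatA N) := by
      funext e; exact δ.scrA_apply_of_not_mem i (Φf e) (Af e) hb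
    rw [hfun]
    exact analyticAt_const

/-- **The coarse datum `B = Q(ηA)` of (3.30) is analytic along the family** (all bonds of `□₀` at once; `Q` a continuous linear map).
[cite: Balaban1987RG1, (3.30) p.276, p.276 («explicitly given analytic functions of 𝐔»)] -/
theorem analyticAt_fldB (hη : 0 ≤ i.η)
    (hA : ∀ b ∈ (i.regionT 5).bonds, AnalyticAt ℂ (fun e => Af e b) e₀) (hh : ∀ b ∈ (i.regionT 5).bonds, AnalyticAt ℂ (fun e => δ.hBox (Φf e) b) e₀)
    (hsm : ∀ b ∈ (i.regionT 5).bonds, i.η * (‖Af e₀ b‖ + ‖δ.hBox (Φf e₀) b‖) ≤ 1 / 4) :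
    AnalyticAt ℂ (fun e => δ.fldB i (Φf e) (Af e)) e₀ := by
  have hsc : AnalyticAt ℂ (fun e => δ.scrA i (Φf e) (Af e)) e₀ :=
    AnalyticAt.pi fun b => analyticAt_scrA_apply δ i hη b (hA b) (hh b) (hsm b)
  show AnalyticAt ℂ (fun e => δ.Q (((i.η : ℝ) : ℂ) • δ.scrA i (Φf e) (Af e))) e₀
  exact (δ.Q.analyticAt _).fun_comp hsc.fun_const_smul

end Presentation

/-! ## §3. At the presented run `χ.withDatum δ`: file 1's datum law from ONE law about `h(𝐔)`; `hKan`, `hA2an` there -/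

section WithDatum

variable {P : Params} {N M : ℕ} {𝒴 𝒵 : Type} [NormedAddCommGroup 𝒴] [NormedSpace ℂ 𝒴] [NormedAddCommGroup 𝒵] [NormedSpace ℂ 𝒵]
  {Rz : Sect2.Residual P (MatA N)} {cB : ℝ} (χ : ChartB12Run P N M 𝒴 𝒵) (δ : DatumB12Pres P N)

/-- **FILE 1's DATUM LAW (iii) AT A PRESENTED RUN, DERIVED**: for `(𝐔, 𝐉)(e₀)` in the (3.40)-space of record and `𝐀(e₀)` in the class (3.31) (`A331Of`: `|𝐀| < α₂` on `□₀`),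
along every analytic family of the variables the coarse datum `B = (χ.withDatum δ).fldB` is analytic — from module E's displayed (3.27)-type law `hh` (`|h(𝐔)(b)| < α′` on the
bonds of `□₀` for `(𝐔, 𝐉)` in the (3.40)-space; verbatim the hypothesis of `Node00.ChartB12Run.dat_lt_withDatum`), `0 ≤ η`, `η(α₂ + α′) ≤ 1/8`, and ONE displayed law `hhan`:
«`h(𝐔)` is analytic along analytic families of `𝐔` in the (3.40)-space, bondwise on `□₀`» (p. 276). [cite: Balaban1987RG1, (3.26)-(3.27) p.275, p.276, (3.30)-(3.31) p.276, (3.40) p.278] -/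
theorem hBan_withDatum (hη : 0 ≤ χ.idx.η) {α' : ℝ}
    (hh : ∀ Φ : FieldPair P 0 (MatA N)ˣ (MatA N),
      Φ ∈ space (suModel N) (χ.toResid.frameBox Rz) (χ.toResid.csBox cB) ((1 + 2 * χ.toResid.consts.β) * χ.toResid.consts.α₀)
          ((1 + 2 * χ.toResid.consts.β) * χ.toResid.consts.α₁) χ.toResid.α₀ →
        ∀ b ∈ (χ.idx.regionT 5).bonds, ‖δ.hBox Φ b‖ < α')
    (hsmall : χ.idx.η * (χ.α₂ + α') ≤ 1 / 8)
    (hhan : ∀ {E : Type} [NormedAddCommGroup E] [NormedSpace ℂ E] {Φf : E → FieldPair P 0 (MatA N)ˣ (MatA N)}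
      {Af Bf : E → PBond P 0 → MatA N} {e₀ : E}, LettersAnalyticAt Φf Af Bf e₀ →
        Φf e₀ ∈ space (suModel N) (χ.toResid.frameBox Rz) (χ.toResid.csBox cB) ((1 + 2 * χ.toResid.consts.β) * χ.toResid.consts.α₀)
            ((1 + 2 * χ.toResid.consts.β) * χ.toResid.consts.α₁) χ.toResid.α₀ →
          ∀ b ∈ (χ.idx.regionT 5).bonds, AnalyticAt ℂ (fun e => δ.hBox (Φf e) b) e₀)
    {E : Type} [NormedAddCommGroup E] [NormedSpace ℂ E] {Φf : E → FieldPair P 0 (MatA N)ˣ (MatA N)}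
    {Af Bf : E → PBond P 0 → MatA N} {e₀ : E} (hLe : LettersAnalyticAt Φf Af Bf e₀)
    (hΦ : Φf e₀ ∈ space (suModel N) ((χ.withDatum δ).toResid.frameBox Rz) ((χ.withDatum δ).toResid.csBox cB)
      ((1 + 2 * (χ.withDatum δ).toResid.consts.β) * (χ.withDatum δ).toResid.consts.α₀)
      ((1 + 2 * (χ.withDatum δ).toResid.consts.β) * (χ.withDatum δ).toResid.consts.α₁) (χ.withDatum δ).toResid.α₀)
    (hA : Af e₀ ∈ (χ.withDatum δ).toResid.A331) :
    AnalyticAt ℂ (fun e => (χ.withDatum δ).fldB (Φf e) (Af e)) e₀ := by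
  have hA' : Af e₀ ∈ A331Of N χ.idx χ.α₂ χ.β₀ := hA
  have hhb := hh (Φf e₀) hΦ
  refine analyticAt_fldB δ χ.idx hη (fun b _ => hLe.2.2.1 b) (hhan hLe hΦ) fun b hb => ?_
  have h1 : ‖Af e₀ b‖ < χ.α₂ := norm_apply_lt_of_mem_A331Of hA' hb
  have h2 : ‖δ.hBox (Φf e₀) b‖ < α' := hhb b hb
  nlinarith [h1, h2, hsmall, hη]

variable [CompleteSpace 𝒴] [CompleteSpace 𝒵]

/-- **`hKan` AT THE PRESENTED RUN** — `ChartB12Inputs.hKan` for `χ.withDatum δ` from the chart laws there, `W`∕`T` analytic on their balls, module E's (3.27)-type size law,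
`0 ≤ η`, `η(α₂ + α′) ≤ 1/8` and the p. 276 law `hhan` about `h(𝐔)` (file 1's `hKan_of_chart` with its datum law supplied by `hBan_withDatum`).
[cite: Balaban1987RG1, Lemma 4 p.280, (3.37) p.277, p.276] [cite: Balaban1985Variational, Prop. 9 p.309] -/
theorem hKan_withDatum (laws : ChartB12Laws Rz cB (χ.withDatum δ))
    (hWa : AnalyticOnNhd ℂ χ.W {Y : 𝒴 | ‖Y‖ < χ.a₃}) (hTa : AnalyticOnNhd ℂ χ.T {Y : 𝒴 | ‖Y‖ < χ.ε₄ + χ.a})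
    (hη : 0 ≤ χ.idx.η) {α' : ℝ}
    (hh : ∀ Φ : FieldPair P 0 (MatA N)ˣ (MatA N),
      Φ ∈ space (suModel N) (χ.toResid.frameBox Rz) (χ.toResid.csBox cB) ((1 + 2 * χ.toResid.consts.β) * χ.toResid.consts.α₀)
          ((1 + 2 * χ.toResid.consts.β) * χ.toResid.consts.α₁) χ.toResid.α₀ →
        ∀ b ∈ (χ.idx.regionT 5).bonds, ‖δ.hBox Φ b‖ < α')
    (hsmall : χ.idx.η * (χ.α₂ + α') ≤ 1 / 8)
    (hhan : ∀ {E : Type} [NormedAddCommGroup E] [NormedSpace ℂ E] {Φf : E → FieldPair P 0 (MatA N)ˣ (MatA N)}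
      {Af Bf : E → PBond P 0 → MatA N} {e₀ : E}, LettersAnalyticAt Φf Af Bf e₀ →
        Φf e₀ ∈ space (suModel N) (χ.toResid.frameBox Rz) (χ.toResid.csBox cB) ((1 + 2 * χ.toResid.consts.β) * χ.toResid.consts.α₀)
            ((1 + 2 * χ.toResid.consts.β) * χ.toResid.consts.α₁) χ.toResid.α₀ →
          ∀ b ∈ (χ.idx.regionT 5).bonds, AnalyticAt ℂ (fun e => δ.hBox (Φf e) b) e₀)
    {E : Type} [NormedAddCommGroup E] [NormedSpace ℂ E] {Φf : E → FieldPair P 0 (MatA N)ˣ (MatA N)}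
    {Af Bf : E → PBond P 0 → MatA N} {e₀ : E} (τ : ℝ) (hLe : LettersAnalyticAt Φf Af Bf e₀)
    (hΦ : Φf e₀ ∈ space (suModel N) ((χ.withDatum δ).toResid.frameBox Rz) ((χ.withDatum δ).toResid.csBox cB)
      ((1 + 2 * (χ.withDatum δ).toResid.consts.β) * (χ.withDatum δ).toResid.consts.α₀)
      ((1 + 2 * (χ.withDatum δ).toResid.consts.β) * (χ.withDatum δ).toResid.consts.α₁) (χ.withDatum δ).toResid.α₀)
    (hA : Af e₀ ∈ (χ.withDatum δ).toResid.A331) (hτ0 : 0 ≤ τ) (hτ1 : τ ≤ 1) (hB' : ‖Bf e₀‖ < (χ.withDatum δ).toResid.consts.α₃) (b : PBond P 0) :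
    AnalyticAt ℂ (fun e => (χ.withDatum δ).K (Φf e) (Af e) τ b) e₀ :=
  hKan_of_chart laws hWa hTa (fun hLe' hΦ' hA' => hBan_withDatum χ δ hη hh hsmall hhan hLe' hΦ' hA') τ hLe hΦ hA hτ0 hτ1 hB' b

/-- **`hA2an` AT THE PRESENTED RUN** — `ChartB12Inputs.hA2an` for `χ.withDatum δ`, as `hKan_withDatum`. [cite: Balaban1987RG1, Lemma 4 p.280, (3.50) pp.279-280, p.276]
[cite: Balaban1985Variational, Prop. 9 p.309] -/
theorem hA2an_withDatum (laws : ChartB12Laws Rz cB (χ.withDatum δ))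
    (hWa : AnalyticOnNhd ℂ χ.W {Y : 𝒴 | ‖Y‖ < χ.a₃}) (hTa : AnalyticOnNhd ℂ χ.T {Y : 𝒴 | ‖Y‖ < χ.ε₄ + χ.a})
    (hη : 0 ≤ χ.idx.η) {α' : ℝ}
    (hh : ∀ Φ : FieldPair P 0 (MatA N)ˣ (MatA N),
      Φ ∈ space (suModel N) (χ.toResid.frameBox Rz) (χ.toResid.csBox cB) ((1 + 2 * χ.toResid.consts.β) * χ.toResid.consts.α₀)
          ((1 + 2 * χ.toResid.consts.β) * χ.toResid.consts.α₁) χ.toResid.α₀ →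
        ∀ b ∈ (χ.idx.regionT 5).bonds, ‖δ.hBox Φ b‖ < α')
    (hsmall : χ.idx.η * (χ.α₂ + α') ≤ 1 / 8)
    (hhan : ∀ {E : Type} [NormedAddCommGroup E] [NormedSpace ℂ E] {Φf : E → FieldPair P 0 (MatA N)ˣ (MatA N)}
      {Af Bf : E → PBond P 0 → MatA N} {e₀ : E}, LettersAnalyticAt Φf Af Bf e₀ →
        Φf e₀ ∈ space (suModel N) (χ.toResid.frameBox Rz) (χ.toResid.csBox cB) ((1 + 2 * χ.toResid.consts.β) * χ.toResid.consts.α₀)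
            ((1 + 2 * χ.toResid.consts.β) * χ.toResid.consts.α₁) χ.toResid.α₀ →
          ∀ b ∈ (χ.idx.regionT 5).bonds, AnalyticAt ℂ (fun e => δ.hBox (Φf e) b) e₀)
    {E : Type} [NormedAddCommGroup E] [NormedSpace ℂ E] {Φf : E → FieldPair P 0 (MatA N)ˣ (MatA N)}
    {Af Bf : E → PBond P 0 → MatA N} {e₀ : E} (τ : ℝ) (hLe : LettersAnalyticAt Φf Af Bf e₀)
    (hΦ : Φf e₀ ∈ space (suModel N) ((χ.withDatum δ).toResid.frameBox Rz) ((χ.withDatum δ).toResid.csBox cB)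
      ((1 + 2 * (χ.withDatum δ).toResid.consts.β) * (χ.withDatum δ).toResid.consts.α₀)
      ((1 + 2 * (χ.withDatum δ).toResid.consts.β) * (χ.withDatum δ).toResid.consts.α₁) (χ.withDatum δ).toResid.α₀)
    (hA : Af e₀ ∈ (χ.withDatum δ).toResid.A331) (hτ0 : 0 ≤ τ) (hτ1 : τ ≤ 1) (hB' : ‖Bf e₀‖ < (χ.withDatum δ).toResid.consts.α₃) (b : PBond P 0) :
    AnalyticAt ℂ (fun e => (χ.withDatum δ).A₂ (Φf e) (Af e) τ (Bf e) b) e₀ :=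
  hA2an_of_chart laws hWa hTa (fun hLe' hΦ' hA' => hBan_withDatum χ δ hη hh hsmall hhan hLe' hΦ' hA') τ hLe hΦ hA hτ0 hτ1 hB' b

/-- **LEMMA 4 (3.53) AT THE GROUP OF RECORD OF A PRESENTED RUN WITHOUT THE ANALYTICITY FIELDS AND WITHOUT THE DATUM-ANALYTICITY LAW** — file 1's
`leaf_of_chart_of_analytic` at `χ.withDatum δ` with (iii) supplied by `hBan_withDatum`: `B12LeafOfRecord Rz cB (χ.withDatum δ).toResid` from «X ⊂ □̃²», the seven
restrictions, the by-reference residue `inputsRef`, the chart laws at the presented run, `W`∕`T` analytic on their balls, module E's (3.27)-type size law, `0 ≤ η`,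
`η(α₂ + α′) ≤ 1/8`, the p. 276 law about `h(𝐔)`, and `0 < cB`.  NOT a discharge of N09. [cite: Balaban1987RG1, Lemma 4 (3.53) p.280, p.273, p.276] [cite: Balaban1985Variational, Prop. 9 p.309] -/
theorem leaf_withDatum_of_analytic [NeZero N] (laws : ChartB12Laws Rz cB (χ.withDatum δ)) (hX : χ.idx.XSites ⊆ χ.idx.boxT 2)
    (hB : 1 ≤ (χ.withDatum δ).toResid.consts.B₃) (hY : 1 ≤ (χ.withDatum δ).toResid.consts.B₃ ^ 2 * (χ.withDatum δ).toResid.consts.O₁ * (χ.withDatum δ).toResid.consts.M)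
    (hα₁ : 16 * ((χ.withDatum δ).toResid.consts.O₁ * (χ.withDatum δ).toResid.consts.M * (χ.withDatum δ).toResid.consts.α₁) ≤ (χ.withDatum δ).toResid.consts.β)
    (hL10 : 1 + 10 * (χ.withDatum δ).toResid.consts.β ≤ (χ.withDatum δ).toResid.consts.L ^ 2) (hB'' : 0 ≤ (χ.withDatum δ).toResid.B₃'')
    (hres'' : (χ.withDatum δ).toResid.B₃'' * (χ.withDatum δ).toResid.consts.α₃ ≤
      (χ.withDatum δ).toResid.consts.β * (χ.withDatum δ).toResid.consts.L⁻¹ ^ 2 * (χ.withDatum δ).toResid.consts.α₀)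
    (hresJ : 4 * ((P.d - 1) * ((2 : ℝ) * B12Eq311CurrentExpansion.C311 1)) *
      ((χ.withDatum δ).toResid.consts.B₃ ^ 2 * (χ.withDatum δ).toResid.consts.O₁ * (χ.withDatum δ).toResid.consts.M) ^ 2 * (χ.withDatum δ).toResid.consts.α₀ ≤
        (χ.withDatum δ).toResid.consts.β)
    (inputsRef : ∀ (Φ : FieldPair P 0 (MatA N)ˣ (MatA N)) (A : PBond P 0 → MatA N) (τ : ℝ) (B' : PBond P 0 → MatA N),
      Φ ∈ space (suModel N) ((χ.withDatum δ).toResid.frameBox Rz) ((χ.withDatum δ).toResid.csBox cB)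
          ((1 + 2 * (χ.withDatum δ).toResid.consts.β) * (χ.withDatum δ).toResid.consts.α₀)
          ((1 + 2 * (χ.withDatum δ).toResid.consts.β) * (χ.withDatum δ).toResid.consts.α₁) (χ.withDatum δ).toResid.α₀ →
        A ∈ (χ.withDatum δ).toResid.A331 → 0 ≤ τ → τ ≤ 1 → ‖B'‖ < (χ.withDatum δ).toResid.consts.α₃ →
          JInputsRef (suModel N) (χ.withDatum δ).toResid.consts ((χ.withDatum δ).toResid.frameX Rz) ((χ.withDatum δ).toResid.frameBox Rz)
            ((χ.withDatum δ).toResid.csX cB) ((χ.withDatum δ).toResid.csBox cB) (χ.withDatum δ).toResid.regionY (B12Lemma4Models.slProj N)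
            (χ.withDatum δ).toResid.idx.η (χ.withDatum δ).toResid.B₃'' (χ.withDatum δ).toResid.α₀ (χ.withDatum δ).toResid.idx.j τ ‖B'‖
            ((χ.withDatum δ).K Φ A τ) ((χ.withDatum δ).A₂ Φ A τ B') ((χ.withDatum δ).H Φ A) ((χ.withDatum δ).H₁ Φ A))
    (hWa : AnalyticOnNhd ℂ χ.W {Y : 𝒴 | ‖Y‖ < χ.a₃}) (hTa : AnalyticOnNhd ℂ χ.T {Y : 𝒴 | ‖Y‖ < χ.ε₄ + χ.a})
    (hη : 0 ≤ χ.idx.η) {α' : ℝ}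
    (hh : ∀ Φ : FieldPair P 0 (MatA N)ˣ (MatA N),
      Φ ∈ space (suModel N) (χ.toResid.frameBox Rz) (χ.toResid.csBox cB) ((1 + 2 * χ.toResid.consts.β) * χ.toResid.consts.α₀)
          ((1 + 2 * χ.toResid.consts.β) * χ.toResid.consts.α₁) χ.toResid.α₀ →
        ∀ b ∈ (χ.idx.regionT 5).bonds, ‖δ.hBox Φ b‖ < α')
    (hsmall : χ.idx.η * (χ.α₂ + α') ≤ 1 / 8)
    (hhan : ∀ {E : Type} [NormedAddCommGroup E] [NormedSpace ℂ E] {Φf : E → FieldPair P 0 (MatA N)ˣ (MatA N)}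
      {Af Bf : E → PBond P 0 → MatA N} {e₀ : E}, LettersAnalyticAt Φf Af Bf e₀ →
        Φf e₀ ∈ space (suModel N) (χ.toResid.frameBox Rz) (χ.toResid.csBox cB) ((1 + 2 * χ.toResid.consts.β) * χ.toResid.consts.α₀)
            ((1 + 2 * χ.toResid.consts.β) * χ.toResid.consts.α₁) χ.toResid.α₀ →
          ∀ b ∈ (χ.idx.regionT 5).bonds, AnalyticAt ℂ (fun e => δ.hBox (Φf e) b) e₀)
    (hcB : 0 < cB) : B12LeafOfRecord Rz cB (χ.withDatum δ).toResid :=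
  leaf_of_chart_of_analytic laws hX hB hY hα₁ hL10 hB'' hres'' hresJ inputsRef hWa hTa
    (fun hLe' hΦ' hA' => hBan_withDatum χ δ hη hh hsmall hhan hLe' hΦ' hA') hcB

end WithDatum

/-! ## §4. At def-T's v1.7 H-PARAMETER: the `h09` binder of dag-n12-d's S-bound four-pin engine at the [B12]-PINNED parameter `θ.pinB12 lam12`, charted `lam12` -/

section PinB12

variable (F : T4Family) (N : ℕ) [NeZero N]

/-- **N09's ROW `h09` OF THE S-BOUND FOUR-PIN ENGINE AT THE [B12]-PINNED v1.7 PARAMETER, CHARTED LAYER, WITHOUT THE ANALYTICITY FIELDS** — dag-n12-d's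
`nodes₁₃CoPH_upS_fourPinW₀_pointed` (`Thm/BalabanUVNodesN12AtRecord13SepCoPHSockets` :116) reads `h09 : ∀ P, B12Sec2to5.Lemma4Printed (θ.toStage13Params.res.X P).F12
(θ.toStage13Params.res.X P).c12` at a generic `θ : Stage13HParams`; at `θ := θ₀.pinB12 lam12` (def-T `Record13CarriersCoPH` :106, an `X`-re-binding over `XB12OfRecord₁₂`, all faces
`rfl`) with the CHARTED layer `lam12 := fun q => (χ q).toResid` that binder, run `P`, IS file 1's §4 (`lemma4Printed_F12OfRecord₁₂_of_chart_of_analytic` at `θ₀.toStage12Params`,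
by `rfl` through `Stage13Params.pinB12_X` ∕ `withB12`) — supplied here from the run's chart laws, «X ⊂ □̃²», the seven restrictions, `inputsRef`, `W`∕`T` analytic, the
datum law, and v1.7 admissibility.  NOT a discharge of N09 (hypotheses displayed); count-neutral.
[cite: Balaban1987RG1, Lemma 4 (3.53) p.280, p.273, p.276] [cite: Balaban1985Variational, Prop. 9 p.309] -/
theorem lemma4Printed_pinB12_of_chart_of_analytic (θ : Stage13HParams F N) (hθ : θ.Admissible F N)
    {𝒴 𝒵 : B12.RunParams → Type} [∀ q, NormedAddCommGroup (𝒴 q)] [∀ q, NormedSpace ℂ (𝒴 q)] [∀ q, CompleteSpace (𝒴 q)]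
    [∀ q, NormedAddCommGroup (𝒵 q)] [∀ q, NormedSpace ℂ (𝒵 q)] [∀ q, CompleteSpace (𝒵 q)]
    (χ : ∀ q : B12.RunParams, ChartB12Run (F.P q.K) N θ.τ9.M (𝒴 q) (𝒵 q)) (P : B12.RunParams)
    (laws : ChartB12Laws (θ.Rz P.K) θ.s2.cB (χ P)) (hX : (χ P).idx.XSites ⊆ (χ P).idx.boxT 2)
    (hB : 1 ≤ (χ P).toResid.consts.B₃) (hY : 1 ≤ (χ P).toResid.consts.B₃ ^ 2 * (χ P).toResid.consts.O₁ * (χ P).toResid.consts.M)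
    (hα₁ : 16 * ((χ P).toResid.consts.O₁ * (χ P).toResid.consts.M * (χ P).toResid.consts.α₁) ≤ (χ P).toResid.consts.β)
    (hL10 : 1 + 10 * (χ P).toResid.consts.β ≤ (χ P).toResid.consts.L ^ 2) (hB'' : 0 ≤ (χ P).toResid.B₃'')
    (hres'' : (χ P).toResid.B₃'' * (χ P).toResid.consts.α₃ ≤ (χ P).toResid.consts.β * (χ P).toResid.consts.L⁻¹ ^ 2 * (χ P).toResid.consts.α₀)
    (hresJ : 4 * (((F.P P.K).d - 1) * ((2 : ℝ) * B12Eq311CurrentExpansion.C311 1)) *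
      ((χ P).toResid.consts.B₃ ^ 2 * (χ P).toResid.consts.O₁ * (χ P).toResid.consts.M) ^ 2 * (χ P).toResid.consts.α₀ ≤ (χ P).toResid.consts.β)
    (inputsRef : ∀ (Φ : FieldPair (F.P P.K) 0 (MatA N)ˣ (MatA N)) (A : PBond (F.P P.K) 0 → MatA N) (τ : ℝ) (B' : PBond (F.P P.K) 0 → MatA N),
      Φ ∈ space (suModel N) ((χ P).toResid.frameBox (θ.Rz P.K)) ((χ P).toResid.csBox θ.s2.cB)
          ((1 + 2 * (χ P).toResid.consts.β) * (χ P).toResid.consts.α₀) ((1 + 2 * (χ P).toResid.consts.β) * (χ P).toResid.consts.α₁) (χ P).toResid.α₀ →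
        A ∈ (χ P).toResid.A331 → 0 ≤ τ → τ ≤ 1 → ‖B'‖ < (χ P).toResid.consts.α₃ →
          JInputsRef (suModel N) (χ P).toResid.consts ((χ P).toResid.frameX (θ.Rz P.K)) ((χ P).toResid.frameBox (θ.Rz P.K))
            ((χ P).toResid.csX θ.s2.cB) ((χ P).toResid.csBox θ.s2.cB) (χ P).toResid.regionY (B12Lemma4Models.slProj N) (χ P).toResid.idx.η
            (χ P).toResid.B₃'' (χ P).toResid.α₀ (χ P).toResid.idx.j τ ‖B'‖ ((χ P).K Φ A τ) ((χ P).A₂ Φ A τ B') ((χ P).H Φ A) ((χ P).H₁ Φ A))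
    (hWa : AnalyticOnNhd ℂ (χ P).W {Y : 𝒴 P | ‖Y‖ < (χ P).a₃}) (hTa : AnalyticOnNhd ℂ (χ P).T {Y : 𝒴 P | ‖Y‖ < (χ P).ε₄ + (χ P).a})
    (hBan : ∀ {E : Type} [NormedAddCommGroup E] [NormedSpace ℂ E] {Φf : E → FieldPair (F.P P.K) 0 (MatA N)ˣ (MatA N)}
      {Af Bf : E → PBond (F.P P.K) 0 → MatA N} {e₀ : E}, LettersAnalyticAt Φf Af Bf e₀ →
        Φf e₀ ∈ space (suModel N) ((χ P).toResid.frameBox (θ.Rz P.K)) ((χ P).toResid.csBox θ.s2.cB)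
            ((1 + 2 * (χ P).toResid.consts.β) * (χ P).toResid.consts.α₀) ((1 + 2 * (χ P).toResid.consts.β) * (χ P).toResid.consts.α₁) (χ P).toResid.α₀ →
          Af e₀ ∈ (χ P).toResid.A331 → AnalyticAt ℂ (fun e => (χ P).fldB (Φf e) (Af e)) e₀) :
    B12Sec2to5.Lemma4Printed ((θ.pinB12 F N (fun q => (χ q).toResid)).toStage13Params.res.X P).F12
      ((θ.pinB12 F N (fun q => (χ q).toResid)).toStage13Params.res.X P).c12 :=
  lemma4Printed_F12OfRecord₁₂_of_chart_of_analytic F N θ.toStage12Params hθ.toStage12 χ P laws hX hB hY hα₁ hL10 hB'' hres'' hresJ inputsRef hWa hTa hBan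

end PinB12

end Summit.QuantumFields.YangMills.BalabanUVNodes.N09ChartDatumAnalytic

end
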